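import Summits.Ventures.YMGap.RobustBall.UniformMassGapS
import Summits.Ventures.YMGap.RobustBall.AxialPairRows
import Summits.Ventures.YMGap.RobustBall.IsotropicPairWitness
import Summits.Ventures.YMGap.RobustBall.RectangleLoopFamily
import Summits.Ventures.YMGap.RobustBall.TrailLoopFamily
import HarnessLib

/-!
# Venture YMGap, track ROBUST-BALL (Y2) — the INFINITE-RANGE members and named loop families, UNIFORMLY

HONEST FRAMING. WHAT THIS IS: a venture file (cell `pub-ymgap`, track Y2 ROBUST-BALL, seat rb-p1, theorems only): the directive stresses a
NON-LOCAL norm; the tree's explicit infinite-range members (which lie in NO tier-1 ball: `not_memBallZd_axialPairWitness`,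
`not_memBallZd_isotropicPairWitness`, `not_memBallZd_rectFamily`) are re-read through the uniform tier-2 rows of `UniformMassGapS.lean`, so each
now carries ONE explicit rate and ONE constant for all its DLR states (`SU(2)`, `d = 4`, 't Hooft slot `β_W/4`):
* ALL RECTANGLES AT ONCE (`|c_{x,ab,R,T}| ≤ 64^{−(R+T)}`, any signs/positions), `β_W = 1/16`: `su2_rectFamily_uniform_1_16` — one DLR state,
  rate `log 2`, constant `16 n²`; every `N ≥ 2` at 't Hooft `1/64` (`|c| ≤ ½·64^{−(R+T)}`): rate `log (6/5)`, `8N n²`;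
* ALL CLOSED TRAILS with `‖c‖_{log 2} ≤ 0.143`: `su2_allTrails_uniform_1_16` (rate `log 2`);
* the AXIAL PLAQUETTE-PAIR WITNESS `τ (1/10)^{dist}(Re tr U_p/2)(Re tr U_q/2)`, `|τ| ≤ 1/320`, `β_W = 1/16`: `su2_axialPair_uniform_1_16`
  (rate `log (3/2)`, constant `16 n²`); the ISOTROPIC PAIR WITNESS `|τ| ≤ 1/10000`: `su2_isotropicPair_uniform_1_16` (rate `log (3/2)`).
WHAT THIS IS NOT: the same certificates as the landed pointwise rows (`AxialPairRows`, `IsotropicPairWitness`, `RectangleLoopFamily`,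
`TrailLoopFamily`); strong-coupling LATTICE statements, nothing about the continuum or a Clay-sense mass gap.
-/

noncomputable section

open MeasureTheory Filter Function Topology Real Finset
open Literature.Probability.LatticeModels
open Literature.Probability.LatticeModels.DobrushinMetric
open Literature.MathematicalPhysics.QuantumLattice
open Literature.MathematicalPhysics.QuantumFieldTheory hiding ZdEdge Site

namespace Summit.Ventures.YMGap.RobustBall

/-! ### All rectangles, all closed trails -/

/-- **ALL RECTANGLES, UNIFORMLY** (`SU(2)`, `d = 4`, `β_W = 1/16`, `|c_{x,ab,R,T}| ≤ 64^{−(R+T)}`): exactly one DLR state and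
`PerturbedClusteringS … (log 2) 16` — one rate, one constant for the whole (infinite-range) family of couplings. [folklore] -/
theorem su2_rectFamily_uniform_1_16 {c : RectIdx 4 → ℝ} (hc : ∀ i, |c i| ≤ (1 / 64 : ℝ) ^ (i.2.1 + i.2.2 + 2)) :
    HasUniqueGibbsMeasure (perturbedYMS (d := 4) (fundamentalRep (Fin 2)) (2 * ((1 / 16 : ℝ) / 4)) (loopFamilyAction (d := 4) 2 rectLoop c)) ∧
      PerturbedClusteringS 4 2 ((1 / 16 : ℝ) / 4) (loopFamilyAction (d := 4) 2 rectLoop c) (Real.log 2) 16 := by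
  have hq : exp (Real.log 2) = 2 := Real.exp_log (by norm_num)
  have h := loopNormLE_rectLoop (d := 4) (w := Real.log 2) (ρ := 1 / 64) (τ := 1) (c := c)
    (Real.log_nonneg (by norm_num)) (by norm_num) (by norm_num) (by rw [hq]; norm_num)
    (fun i => by rw [one_mul]; exact hc i)
  have hP : Fintype.card {p : Fin 4 × Fin 4 // p.1 < p.2} = 6 := by decide
  rw [hq, hP] at h
  exact su2_uniformMassGapOnLoopBall_1_16.2 _ rectLoop c finite_fibre_rectLoop (h.mono (by norm_num))

/-- **Every `N ≥ 2`, all rectangles, 't Hooft `1/64`, `|c| ≤ ½·64^{−(R+T)}`**: one DLR state, rate `log (6/5)`, constant `8N n²`. [folklore] -/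
theorem suN_rectFamily_uniform_1_64 {N : ℕ} (hN : 2 ≤ N) {c : RectIdx 4 → ℝ}
    (hc : ∀ i, |c i| ≤ 1 / 2 * (1 / 64 : ℝ) ^ (i.2.1 + i.2.2 + 2)) :
    HasUniqueGibbsMeasure (perturbedYMS (d := 4) (fundamentalRep (Fin N)) (N * (1 / 64 : ℝ)) (loopFamilyAction (d := 4) N rectLoop c)) ∧
      PerturbedClusteringS 4 N (1 / 64) (loopFamilyAction (d := 4) N rectLoop c) (Real.log (6 / 5)) (8 * N) := by
  have hq : exp (Real.log (6 / 5)) = 6 / 5 := Real.exp_log (by norm_num)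
  have h := loopNormLE_rectLoop (d := 4) (w := Real.log (6 / 5)) (ρ := 1 / 64) (τ := 1 / 2) (c := c)
    (Real.log_nonneg (by norm_num)) (by norm_num) (by norm_num) (by rw [hq]; norm_num) hc
  have hP : Fintype.card {p : Fin 4 × Fin 4 // p.1 < p.2} = 6 := by decide
  rw [hq, hP] at h
  exact (suN_uniformMassGapOnLoopBall_1_64 hN).2 _ rectLoop c finite_fibre_rectLoop (h.mono (by norm_num))

/-- **ALL CLOSED TRAILS, UNIFORMLY** (`SU(2)`, `d = 4`, `β_W = 1/16`, `‖c‖_{log 2} ≤ 0.143` over the family of all closed lattice trails):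
one DLR state, rate `log 2`, constant `16 n²`. [folklore] -/
theorem su2_allTrails_uniform_1_16 {c : TrailIdx 4 → ℝ} (h : LoopNormLE (Real.log 2) trailLoop c (143 / 1000)) :
    HasUniqueGibbsMeasure (perturbedYMS (d := 4) (fundamentalRep (Fin 2)) (2 * ((1 / 16 : ℝ) / 4)) (loopFamilyAction (d := 4) 2 trailLoop c)) ∧
      PerturbedClusteringS 4 2 ((1 / 16 : ℝ) / 4) (loopFamilyAction (d := 4) 2 trailLoop c) (Real.log 2) 16 :=
  su2_uniformMassGapOnLoopBall_1_16.2 _ trailLoop c finite_fibre_trailLoop h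

/-! ### The plaquette-pair witnesses (infinite range, in no tier-1 ball) -/

/-- **THE AXIAL PLAQUETTE-PAIR WITNESS, UNIFORMLY** (`SU(2)`, `d = 4`, `β_W = 1/16`, couplings `τ (1/10)^{dist}`, `|τ| ≤ 1/320`): exactly one
DLR state and `PerturbedClusteringS … (log (3/2)) 16` (the member lies in the ball of the uniform row `su2_uniformRowS32_1_16`). [folklore] -/
theorem su2_axialPair_uniform_1_16 {τ : ℝ} (hτ : |τ| ≤ 1 / 320) :
    HasUniqueGibbsMeasure (perturbedYMS (d := 4) (fundamentalRep (Fin 2)) (2 * ((1 / 16 : ℝ) / 4)) (axialPairWitness (d := 4) 2 τ (1 / 10))) ∧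
      PerturbedClusteringS 4 2 ((1 / 16 : ℝ) / 4) (axialPairWitness (d := 4) 2 τ (1 / 10)) (Real.log (3 / 2)) 16 := by
  have hq : exp (Real.log (3 / 2)) = 3 / 2 := Real.exp_log (by norm_num)
  have hmem := memBallZdS_axialPairWitness (d := 4) (N := 2) (τ := τ) (κ := 1 / 10) (t := Real.log (3 / 2))
    (by norm_num) (by norm_num) (by norm_num) (by norm_num) (Real.log_nonneg (by norm_num)) (by rw [hq]; norm_num)
  rw [hq] at hmem
  have hs := sqrt_two_ge
  have hs0 : (0 : ℝ) < Real.sqrt 2 := by linarith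
  have hτ0 : 0 ≤ |τ| := abs_nonneg τ
  have hdiv : |τ| / Real.sqrt 2 ≤ (1 / 320) / (141421 / 100000) := div_le_div₀ (by norm_num) hτ (by norm_num) hs
  refine su2_uniformRowS32_1_16.2 _ (hmem.mono ?_ ?_)
  · push_cast; nlinarith
  · push_cast
    nlinarith [hdiv, div_nonneg hτ0 hs0.le]

/-- **THE ISOTROPIC PLAQUETTE-PAIR WITNESS, UNIFORMLY** (`SU(2)`, `d = 4`, `β_W = 1/16`, all plaquette pairs coupled by `τ(1/10)^{‖x_p−x_q‖₁}`,
`|τ| ≤ 1/10000`): exactly one DLR state and `PerturbedClusteringS … (log (3/2)) 16`. [folklore] -/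
theorem su2_isotropicPair_uniform_1_16 {τ : ℝ} (hτ : |τ| ≤ 1 / 10000) :
    HasUniqueGibbsMeasure (perturbedYMS (d := 4) (fundamentalRep (Fin 2)) (2 * ((1 / 16 : ℝ) / 4)) (isotropicPairWitness (d := 4) 2 τ (1 / 10))) ∧
      PerturbedClusteringS 4 2 ((1 / 16 : ℝ) / 4) (isotropicPairWitness (d := 4) 2 τ (1 / 10)) (Real.log (3 / 2)) 16 := by
  have hq : exp (Real.log (3 / 2)) = 3 / 2 := Real.exp_log (by norm_num)
  have hmem := memBallZdS_isotropicPairWitness (d := 4) (N := 2) (τ := τ) (κ := 1 / 10) (t := Real.log (3 / 2))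
    (by norm_num) (by norm_num) (by norm_num) (by norm_num) (Real.log_nonneg (by norm_num)) (by rw [hq]; norm_num)
  rw [hq, numOrient_four] at hmem
  have hs := sqrt_two_ge
  have hs0 : (0 : ℝ) < Real.sqrt 2 := by linarith
  have hτ0 : 0 ≤ |τ| := abs_nonneg τ
  have hdiv : |τ| / Real.sqrt 2 ≤ (1 / 10000) / (141421 / 100000) := div_le_div₀ (by norm_num) hτ (by norm_num) hs
  refine su2_uniformRowS32_1_16.2 _ (hmem.mono ?_ ?_)
  · push_cast; nlinarith
  · push_cast
    have heq : (16 : ℝ) * (4 - 1) * 6 * |τ| * (3 / 2) *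
        (((1 + 1 / 10) / (1 - 1 / 10)) ^ 4 + ((1 + 1 / 10 * (3 / 2)) / (1 - 1 / 10 * (3 / 2))) ^ 4) / Real.sqrt 2 =
        16 * (4 - 1) * 6 * (3 / 2) *
        (((1 + 1 / 10) / (1 - 1 / 10)) ^ 4 + ((1 + 1 / 10 * (3 / 2)) / (1 - 1 / 10 * (3 / 2))) ^ 4) * (|τ| / Real.sqrt 2) := by
      ring
    rw [heq]
    nlinarith [hdiv, div_nonneg hτ0 hs0.le]

end Summit.Ventures.YMGap.RobustBall

end
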